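import Summits.CriticalPhenomena.PercolationContinuityZ3.Theorems.PercNearOneGluingNoHeavyQuantGreedyExchange
import HarnessLib

/-!
# QUANT lane R8, T-DEC: OPTIMALITY OF THE SW GREEDY CREDIT FLOW on a Monge staircase, for every prefix of columns simultaneously
# — the ROW LEMMA (Theorem G of `run/shared/lean/prim/quant/FOR-PROVERS-WINDOW-ATOMS.md` §2; lead g25, Lean plan W2 part 2b)

builds on p205010 (kernel theorem, internal audit signed; external expert review pending)

Support file (`--supports stmt-CriticalPhenomena-4575`), QUANT lane lead seat (gen 25), rung R8 of
`run/shared/lean/prim/quant/LADDER.md`.  Theorems only, standard axioms, no sorries.  Continues `…QuantGreedyFlow` / `…QuantGreedyExchange`.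

THEOREM G (abstract form).  Rows and columns are naturals; compatibility `P` is up-closed in the row and in the column; the rates `u` are positive
on compatible cells, ANTITONE in the row (`l < l′`, `P l h` ⟹ `u l′ h ≤ u l h`) and MONGE (`l < l′`, `h < k`, `P l h` ⟹ `u l′ h·u l k ≤ u l h·u l′ k`)
— for DEC these are lead g21's `LawDec.usage_anti_low` / `usage_monge`.  Then for nonnegative data every credit flow ships at most as much as
the SW greedy flow (`Greedy.val_le_gval`), and — by the prefix property — at most as much INTO EVERY PREFIX OF COLUMNS `{h ≤ t}` as the greedy
does (`Greedy.val_le_sum_flow_prefix`): ONE flow is optimal for all prefixes at once.  Proof: induction on the rows; the top row's allocation `r`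
of any flow is compared with the greedy row through `Ψ(r) = Σ r + (greedy value of the other rows on the residual capacities)`, which does not
decrease when `r` is pushed towards the left-packed greedy row column by column (`Greedy.row_lemma`: uncrossing `gval_le_uncross` + truncation
`gval_truncate_le` from part 2a, and the induction hypothesis for the other rows).

* `Greedy.gval` — value of the greedy flow.  `gval_truncate_le`, `gval_le_uncross` — value-function forms of the two exchanges.
* **`Greedy.row_lemma`**, **`Greedy.val_le_gval`**, **`Greedy.val_le_sum_flow_prefix`**.

[this work]; corner rules for Monge arrays: Hoffman 1963 (classical).  The gluing rows served [cite: KozmaNitzan2024, Conjecture 3 (p. 15)];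
product measure [cite: Grimmett1999, §1.3 p. 10].
-/

noncomputable section
namespace Summit.CriticalPhenomena.PercolationContinuityZ3.Theorems
namespace Quant
namespace LawDec
namespace Greedy

open Finset
variable (u : ℕ → ℕ → ℝ) (P : ℕ → ℕ → Prop) [DecidableRel P]

/-- **value of the greedy flow.** [this work] -/
def gval (L H : Finset ℕ) (μ c : ℕ → ℝ) : ℝ := val L H (flow u P L H μ c)

/-! ### Value-function forms of the exchanges (given optimality for the rows `L′`) -/

/-- truncation, value form: adding capacity `τ` at `h₀` raises the greedy value of dearer rows by at most `τ / u l₀ h₀`. [this work] -/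
theorem gval_truncate_le (hu : ∀ l h, P l h → 0 < u l h) (L' H : Finset ℕ) (μ c : ℕ → ℝ)
    (hμ : ∀ l ∈ L', 0 ≤ μ l) (hc : ∀ h ∈ H, 0 ≤ c h)
    (hopt : ∀ c' : ℕ → ℝ, (∀ h ∈ H, 0 ≤ c' h) → ∀ f, IsFlow u P L' H μ c' f → val L' H f ≤ gval u P L' H μ c')
    (l₀ h₀ : ℕ) (hh0 : h₀ ∈ H) (τ : ℝ) (hτ : 0 ≤ τ) (hu0 : 0 < u l₀ h₀) (hanti : ∀ l ∈ L', P l h₀ → u l₀ h₀ ≤ u l h₀) :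
    gval u P L' H μ (fun h => if h = h₀ then c h + τ else c h) ≤ gval u P L' H μ c + τ / u l₀ h₀ := by
  have hc' : ∀ h ∈ H, 0 ≤ (fun h => if h = h₀ then c h + τ else c h) h := by
    intro h hh; dsimp only; split_ifs <;> linarith [hc h hh]
  obtain ⟨φ', hφ', hval⟩ := exists_isFlow_truncate u P L' H μ c l₀ h₀ τ hτ (hc h₀ hh0) hu0 hanti _
    (isFlow_flow u P hu L' H μ _ hμ hc')
  have := hopt c hc φ' hφ'
  unfold gval at this ⊢
  linarith

/-- uncrossing, value form: trading capacity `s` at `h₀` for `w_k·s·u l₀ k/u l₀ h₀` at the weighted columns does not lower the greedy value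
of the rows `L′` (Monge). [this work] -/
theorem gval_le_uncross (hu : ∀ l h, P l h → 0 < u l h) (L' H : Finset ℕ) (μ c : ℕ → ℝ)
    (hμ : ∀ l ∈ L', 0 ≤ μ l) (hc : ∀ h ∈ H, 0 ≤ c h)
    (hopt : ∀ c' : ℕ → ℝ, (∀ h ∈ H, 0 ≤ c' h) → ∀ f, IsFlow u P L' H μ c' f → val L' H f ≤ gval u P L' H μ c')
    (l₀ h₀ : ℕ) (s : ℝ) (hs0 : 0 ≤ s) (hsc : s ≤ c h₀) (hP0 : P l₀ h₀)
    (w : ℕ → ℝ) (hw0 : ∀ k, 0 ≤ w k) (hwh : w h₀ = 0) (hwH : ∀ k, w k ≠ 0 → k ∈ H) (hw1 : ∑ k ∈ H, w k = 1)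
    (hwP : ∀ k, w k ≠ 0 → P l₀ k)
    (hmonge : ∀ l ∈ L', ∀ k, w k ≠ 0 → P l h₀ → u l₀ h₀ * u l k ≤ u l h₀ * u l₀ k)
    (hcompat : ∀ l ∈ L', ∀ k, w k ≠ 0 → P l h₀ → P l k) :
    gval u P L' H μ c ≤ gval u P L' H μ (fun h => c h - (if h = h₀ then s else 0) + w h * s * u l₀ h / u l₀ h₀) := by
  obtain ⟨φ', hφ', hval⟩ := exists_isFlow_uncross u P hu L' H μ c l₀ h₀ s hs0 hsc hP0 w hw0 hwh hwH hw1 hwP hmonge hcompat _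
    (isFlow_flow u P hu L' H μ c hμ hc)
  have hc' : ∀ h ∈ H, 0 ≤ (fun h => c h - (if h = h₀ then s else 0) + w h * s * u l₀ h / u l₀ h₀) h := by
    intro h hh; dsimp only
    have hwt : 0 ≤ w h * s * u l₀ h / u l₀ h₀ := by
      by_cases hwk : w h = 0
      · rw [hwk]; simp
      · exact div_nonneg (mul_nonneg (mul_nonneg (hw0 h) hs0) (hu _ _ (hwP h hwk)).le) (hu _ _ hP0).le
    split_ifs with hh0
    · subst hh0; linarith
    · linarith [hc h hh]
  have := hopt _ hc' φ' hφ'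
  unfold gval at this ⊢
  linarith

/-! ### The row lemma -/

/-- **ROW LEMMA.**  With optimality known for the rows `L′` (all below `l₀`), for every admissible allocation `r` of the row `l₀` (mass `≤ rem`,
supported on compatible columns of `H′ ⊆ H`, within the capacities): `Σ r + gval(L′, c − u l₀ · r) ≤ Σ g + gval(L′, c − u l₀ · g)` for the
left-packed greedy row `g = rowFill l₀ · H′ c rem`. [this work] -/
theorem row_lemma (hu : ∀ l h, P l h → 0 < u l h) (hPh : ∀ l h k, h ≤ k → P l h → P l k)
    (L' H : Finset ℕ) (μ : ℕ → ℝ) (hμ : ∀ l ∈ L', 0 ≤ μ l) (l₀ : ℕ)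
    (hanti : ∀ l ∈ L', ∀ h, P l h → u l₀ h ≤ u l h)
    (hmonge : ∀ l ∈ L', ∀ h k, h < k → P l h → u l₀ h * u l k ≤ u l h * u l₀ k)
    (hopt : ∀ c' : ℕ → ℝ, (∀ h ∈ H, 0 ≤ c' h) → ∀ f, IsFlow u P L' H μ c' f → val L' H f ≤ gval u P L' H μ c') :
    ∀ (H' : Finset ℕ), H' ⊆ H → ∀ (c : ℕ → ℝ), (∀ h ∈ H, 0 ≤ c h) → ∀ (rem : ℝ), 0 ≤ rem → ∀ (r : ℕ → ℝ),
      (∀ k, 0 ≤ r k) → (∀ k, r k ≠ 0 → k ∈ H' ∧ P l₀ k) → (∑ k ∈ H', r k ≤ rem) → (∀ k ∈ H', u l₀ k * r k ≤ c k) →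
      (∑ k ∈ H', r k) + gval u P L' H μ (fun h => c h - u l₀ h * r h) ≤
        (∑ k ∈ H', rowFill u P l₀ k H' c rem) + gval u P L' H μ (fun h => c h - u l₀ h * rowFill u P l₀ h H' c rem) := by
  intro H'
  induction H' using Finset.strongInduction with
  | H H' ih =>
    intro hH'H c hc rem hrem r hr0 hrsupp hrsum hrcap
    by_cases hH' : H'.Nonempty
    swap
    · -- no free column: `r = 0 = rowFill`
      have hE : H' = ∅ := Finset.not_nonempty_iff_eq_empty.1 hH'
      have hr : ∀ k, r k = 0 := fun k => by
        by_contra hne; have := (hrsupp k hne).1; rw [hE] at this; simp at this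
      subst hE
      have e1 : (fun h => c h - u l₀ h * r h) = (fun h => c h - u l₀ h * rowFill u P l₀ h ∅ c rem) := by
        funext h; rw [hr, rowFill_empty]
      rw [e1]; simp [hr, rowFill_empty]
    -- the least free column `h`, the greedy amount `q`, the rest `R`
    set h := H'.min' hH' with hhdef
    have hhH' : h ∈ H' := Finset.min'_mem H' hH'
    have hhH : h ∈ H := hH'H hhH'
    set q := firstFill u P l₀ H' hH' c rem with hqdef
    have hq_eq : rowFill u P l₀ h H' c rem = q := by rw [hhdef]; exact rowFill_min' u P l₀ H' hH' c rem
    set R := ∑ k ∈ H'.erase h, r k with hRdef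
    have hR0 : 0 ≤ R := Finset.sum_nonneg fun k _ => hr0 k
    have hsplit : ∑ k ∈ H', r k = r h + R := by rw [hRdef, Finset.add_sum_erase H' _ hhH']
    have hq0 : 0 ≤ q := firstFill_nonneg u P l₀ H' hH' c rem hrem (by rw [← hhdef]; exact hc h hhH) (fun hp => hu _ _ hp)
    have hqrem : q ≤ rem := firstFill_le_rem u P l₀ H' hH' c rem hrem
    -- `r h ≤ q` and `u l₀ h · q ≤ c h`
    have hrq : r h ≤ q := by
      rw [hqdef]; unfold firstFill; rw [← hhdef]
      split_ifs with hP
      · refine le_min (by linarith [hr0 h]) ?_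
        rw [le_div_iff₀ (hu _ _ hP), mul_comm]; exact hrcap h hhH'
      · by_contra hne; exact hP (hrsupp h (by intro hz; rw [hz] at hne; exact hne le_rfl)).2
    have huq : u l₀ h * q ≤ c h := by
      rw [hqdef]; unfold firstFill; rw [← hhdef]
      split_ifs with hP
      · have hu' := hu _ _ hP
        calc u l₀ h * min rem (c h / u l₀ h) ≤ u l₀ h * (c h / u l₀ h) :=
            mul_le_mul_of_nonneg_left (min_le_right _ _) hu'.le
          _ = c h := by field_simp
      · rw [mul_zero]; exact hc h hhH
    -- the scaling `λ` of the higher columns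
    set lam : ℝ := if R = 0 then 1 else min 1 ((rem - q) / R) with hlamdef
    have hlam0 : 0 ≤ lam := by
      rw [hlamdef]; split_ifs with hR; norm_num
      exact le_min zero_le_one (div_nonneg (by linarith) hR0)
    have hlam1 : lam ≤ 1 := by rw [hlamdef]; split_ifs; exact le_rfl; exact min_le_left _ _
    have hlamR : lam * R ≤ rem - q := by
      rw [hlamdef]; split_ifs with hR
      · rw [hR]; linarith
      · have hRpos : 0 < R := lt_of_le_of_ne hR0 (Ne.symm hR)
        calc min 1 ((rem - q) / R) * R ≤ ((rem - q) / R) * R := mul_le_mul_of_nonneg_right (min_le_right _ _) hR0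
          _ = rem - q := div_mul_cancel₀ _ hRpos.ne'
    -- the slack part `a ≥ 0`
    set a : ℝ := q - r h - (1 - lam) * R with hadef
    have ha0 : 0 ≤ a := by
      rw [hadef, hlamdef]; split_ifs with hR
      · rw [hR]; linarith
      · by_cases hmin : (rem - q) / R ≤ 1
        · rw [min_eq_right hmin]
          have hRpos : 0 < R := lt_of_le_of_ne hR0 (Ne.symm hR)
          have : (1 - (rem - q) / R) * R = R - (rem - q) := by field_simp
          rw [this]; linarith
        · rw [min_eq_left (le_of_lt (not_le.1 hmin))]; linarith
    -- the pushed row `r″`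
    set r'' : ℕ → ℝ := fun k => if k = h then q else lam * r k with hr''def
    have hr''0 : ∀ k, 0 ≤ r'' k := fun k => by
      rw [hr''def]; dsimp only; split_ifs; exact hq0; exact mul_nonneg hlam0 (hr0 k)
    have hr''sum : ∑ k ∈ H', r'' k = q + lam * R := by
      rw [← Finset.add_sum_erase H' _ hhH', hr''def]; dsimp only; rw [if_pos rfl, hRdef, Finset.mul_sum]
      congr 1; exact Finset.sum_congr rfl fun k hk => by rw [if_neg (Finset.ne_of_mem_erase hk)]
    -- STEP A: `Ψ(r) ≤ Ψ(r″)`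
    have hc1 : ∀ k ∈ H, 0 ≤ c k - u l₀ k * r k := by
      intro k hk
      by_cases hkH : k ∈ H'
      · linarith [hrcap k hkH]
      · have : r k = 0 := by by_contra hne; exact hkH (hrsupp k hne).1
        rw [this, mul_zero, sub_zero]; exact hc k hk
    have stepA : gval u P L' H μ (fun k => c k - u l₀ k * r k) ≤ gval u P L' H μ (fun k => c k - u l₀ k * r'' k) + a := by
      -- capacities after uncrossing `(1-λ)·r` from the higher columns into `h`
      set s : ℝ := u l₀ h * ((1 - lam) * R) with hsdef
      set c2 : ℕ → ℝ := fun k => c k - u l₀ k * r k - (if k = h then s else 0) + (if k = h then 0 else (1 - lam) * u l₀ k * r k)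
        with hc2def
      -- (i) uncrossing: `gval(c − u·r) ≤ gval(c2)`
      have h_unc : gval u P L' H μ (fun k => c k - u l₀ k * r k) ≤ gval u P L' H μ c2 := by
        by_cases hmove : (1 - lam) * R = 0
        · have hterm : ∀ k, k ≠ h → (1 - lam) * u l₀ k * r k = 0 := by
            intro k hkh
            rcases mul_eq_zero.1 hmove with h1 | h1
            · rw [h1]; ring
            · by_cases hkH' : k ∈ H'
              · have hle : r k ≤ R := by
                  rw [hRdef]; exact Finset.single_le_sum (fun i _ => hr0 i) (Finset.mem_erase.2 ⟨hkh, hkH'⟩)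
                have hrk : r k = 0 := le_antisymm (by linarith) (hr0 k)
                rw [hrk]; ring
              · have hrk : r k = 0 := by by_contra hne; exact hkH' (hrsupp k hne).1
                rw [hrk]; ring
          have : c2 = fun k => c k - u l₀ k * r k := by
            funext k; rw [hc2def]; dsimp only; rw [hsdef, hmove, mul_zero]
            split_ifs with hkh
            · simp
            · rw [hterm k hkh]; ring
          rw [this]
        · -- genuine move: `R > 0`, `λ < 1`, hence `q > r h ≥ 0` and `P l₀ h`
          have hRne : R ≠ 0 := fun hR => hmove (by rw [hR, mul_zero])
          have hRpos : 0 < R := lt_of_le_of_ne hR0 (Ne.symm hRne)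
          have hmovepos : 0 < (1 - lam) * R := lt_of_le_of_ne (mul_nonneg (by linarith) hR0) (Ne.symm hmove)
          have hPh0 : P l₀ h := by
            by_contra hP
            have hq0' : q = 0 := by rw [hqdef]; unfold firstFill; rw [← hhdef, if_neg hP]
            have : (1 - lam) * R ≤ q - r h := by linarith
            linarith [hr0 h]
          have hs0 : 0 ≤ s := mul_nonneg (hu _ _ hPh0).le hmovepos.le
          have hsc : s ≤ c h - u l₀ h * r h := by
            have : (1 - lam) * R ≤ q - r h := by linarith
            calc s ≤ u l₀ h * (q - r h) := mul_le_mul_of_nonneg_left this (hu _ _ hPh0).le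
              _ = u l₀ h * q - u l₀ h * r h := by ring
              _ ≤ c h - u l₀ h * r h := by linarith
          -- weights `w k = r k / R` on the higher columns
          set w : ℕ → ℝ := fun k => if k = h then 0 else r k / R with hwdef
          have hw0 : ∀ k, 0 ≤ w k := fun k => by rw [hwdef]; dsimp only; split_ifs; exact le_rfl; exact div_nonneg (hr0 k) hR0
          have hwh : w h = 0 := by rw [hwdef]; dsimp only; rw [if_pos rfl]
          have hwne : ∀ k, w k ≠ 0 → k ≠ h ∧ r k ≠ 0 := by
            intro k hk; rw [hwdef] at hk; dsimp only at hk
            by_cases hkh : k = h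
            · rw [if_pos hkh] at hk; exact (hk rfl).elim
            · rw [if_neg hkh] at hk; exact ⟨hkh, fun hz => hk (by rw [hz, zero_div])⟩
          have hwH : ∀ k, w k ≠ 0 → k ∈ H := fun k hk => hH'H (hrsupp k (hwne k hk).2).1
          have hw1 : ∑ k ∈ H, w k = 1 := by
            have : ∑ k ∈ H, w k = ∑ k ∈ H'.erase h, w k := by
              refine (Finset.sum_subset (fun k hk => hH'H (Finset.mem_of_mem_erase hk)) fun k _ hk => ?_).symm
              by_contra hne; exact hk (Finset.mem_erase.2 ⟨(hwne k hne).1, (hrsupp k (hwne k hne).2).1⟩)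
            rw [this]
            have : ∑ k ∈ H'.erase h, w k = ∑ k ∈ H'.erase h, r k / R :=
              Finset.sum_congr rfl fun k hk => by rw [hwdef]; dsimp only; rw [if_neg (Finset.ne_of_mem_erase hk)]
            rw [this, ← Finset.sum_div, ← hRdef, div_self hRne]
          have hwP : ∀ k, w k ≠ 0 → P l₀ k := fun k hk => (hrsupp k (hwne k hk).2).2
          have hlt : ∀ k, w k ≠ 0 → h < k := by
            intro k hk
            have hkH' : k ∈ H' := (hrsupp k (hwne k hk).2).1
            exact lt_of_le_of_ne (by rw [hhdef]; exact Finset.min'_le H' k hkH') (Ne.symm (hwne k hk).1)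
          have key := gval_le_uncross u P hu L' H μ (fun k => c k - u l₀ k * r k) hμ hc1 hopt l₀ h s hs0 hsc hPh0 w hw0 hwh hwH
            hw1 hwP (fun l hl k hk hPl => hmonge l hl h k (hlt k hk) hPl) (fun l hl k hk hPl => hPh l h k (hlt k hk).le hPl)
          have hu0h : u l₀ h ≠ 0 := (hu _ _ hPh0).ne'
          have hc2 : c2 = fun k => (c k - u l₀ k * r k) - (if k = h then s else 0) + w k * s * u l₀ k / u l₀ h := by
            funext k; rw [hc2def, hwdef]; dsimp only
            split_ifs with hkh
            · simp
            · rw [hsdef]; field_simp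
          rw [hc2]; exact key
      -- (ii) truncation: `gval(c2) ≤ gval(c − u·r″) + a`, since `c2 = (c − u·r″) + (u l₀ h·a)·e_h`
      have h_tr : gval u P L' H μ c2 ≤ gval u P L' H μ (fun k => c k - u l₀ k * r'' k) + a := by
        by_cases hPh0 : P l₀ h
        · have hu0 := hu _ _ hPh0
          have hc3 : ∀ k ∈ H, 0 ≤ c k - u l₀ k * r'' k := by
            intro k hk; rw [hr''def]; dsimp only; split_ifs with hkh
            · rw [hkh]; linarith
            · have : u l₀ k * (lam * r k) ≤ u l₀ k * r k := by
                by_cases hrk : r k = 0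
                · rw [hrk]; simp
                · have hu' := (hu _ _ (hrsupp k hrk).2).le
                  have : 0 ≤ u l₀ k * r k * (1 - lam) := mul_nonneg (mul_nonneg hu' (hr0 k)) (by linarith)
                  nlinarith
              linarith [hc1 k hk]
          have e2 : c2 = fun k => if k = h then (c k - u l₀ k * r'' k) + u l₀ h * a else (c k - u l₀ k * r'' k) := by
            funext k; rw [hc2def, hr''def]; dsimp only
            split_ifs with hkh
            · rw [hkh, hsdef, hadef]; ring
            · ring
          rw [e2]
          have := gval_truncate_le u P hu L' H μ (fun k => c k - u l₀ k * r'' k) hμ hc3 hopt l₀ h hhH (u l₀ h * a)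
            (mul_nonneg hu0.le ha0) hu0 (fun l hl hPl => hanti l hl h hPl)
          rw [mul_div_cancel_left₀ _ hu0.ne'] at this
          exact this
        · -- `¬ P l₀ h`: then `q = 0 = r h`, nothing moves, `a = 0`, and `c2 = c − u·r″`
          have hq0' : q = 0 := by rw [hqdef]; unfold firstFill; rw [← hhdef, if_neg hPh0]
          have hrh : r h = 0 := by linarith [hr0 h]
          have hmove : (1 - lam) * R = 0 := by
            have : (1 - lam) * R ≤ 0 := by linarith
            exact le_antisymm this (mul_nonneg (by linarith) hR0)
          have ha : a = 0 := by rw [hadef, hq0', hrh, hmove]; ring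
          have hlamr : ∀ k, lam * r k = r k := by
            intro k
            rcases mul_eq_zero.1 hmove with h1 | h1
            · have : lam = 1 := by linarith
              rw [this, one_mul]
            · by_cases hkh : k ∈ H'.erase h
              · have hrk : r k = 0 := le_antisymm (by
                  have := Finset.single_le_sum (fun i _ => hr0 i) hkh; rw [← hRdef, h1] at this; exact this) (hr0 k)
                rw [hrk, mul_zero]
              · by_cases hkh' : k = h
                · rw [hkh', hrh, mul_zero]
                · have hrk : r k = 0 := by
                    by_contra hne; exact hkh (Finset.mem_erase.2 ⟨hkh', (hrsupp k hne).1⟩)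
                  rw [hrk, mul_zero]
          have e2 : c2 = fun k => c k - u l₀ k * r'' k := by
            funext k; rw [hc2def, hr''def]; dsimp only
            rw [hsdef, hmove, mul_zero]
            split_ifs with hkh
            · rw [hkh, hq0', hrh]; ring
            · rw [hlamr k]
              have : (1 - lam) * u l₀ k * r k = u l₀ k * (r k - lam * r k) := by ring
              rw [this, hlamr k]; ring
          rw [e2, ha, add_zero]
      linarith
    -- STEP B: `Ψ(r″) ≤ Ψ(g)` by the induction hypothesis on `H′.erase h`
    set c' : ℕ → ℝ := fun k => if k = h then c k - u l₀ h * q else c k with hc'def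
    have hc'0 : ∀ k ∈ H, 0 ≤ c' k := by
      intro k hk; rw [hc'def]; dsimp only; split_ifs with hkh
      · rw [hkh]; linarith
      · exact hc k hk
    set ρ : ℕ → ℝ := fun k => if k = h then 0 else lam * r k with hρdef
    have hρ0 : ∀ k, 0 ≤ ρ k := fun k => by rw [hρdef]; dsimp only; split_ifs; exact le_rfl; exact mul_nonneg hlam0 (hr0 k)
    have hρsupp : ∀ k, ρ k ≠ 0 → k ∈ H'.erase h ∧ P l₀ k := by
      intro k hk; rw [hρdef] at hk; dsimp only at hk
      by_cases hkh : k = h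
      · rw [if_pos hkh] at hk; exact (hk rfl).elim
      · rw [if_neg hkh] at hk
        have hrk : r k ≠ 0 := fun hz => hk (by rw [hz, mul_zero])
        exact ⟨Finset.mem_erase.2 ⟨hkh, (hrsupp k hrk).1⟩, (hrsupp k hrk).2⟩
    have hρsum : ∑ k ∈ H'.erase h, ρ k = lam * R := by
      rw [hRdef, Finset.mul_sum]
      exact Finset.sum_congr rfl fun k hk => by rw [hρdef]; dsimp only; rw [if_neg (Finset.ne_of_mem_erase hk)]
    have hρcap : ∀ k ∈ H'.erase h, u l₀ k * ρ k ≤ c' k := by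
      intro k hk
      have hkh := Finset.ne_of_mem_erase hk
      rw [hρdef, hc'def]; dsimp only; rw [if_neg hkh, if_neg hkh]
      by_cases hrk : r k = 0
      · rw [hrk, mul_zero, mul_zero]; exact hc k (hH'H (Finset.mem_of_mem_erase hk))
      · have hu' := (hu _ _ (hrsupp k hrk).2).le
        have h1 : 0 ≤ u l₀ k * r k * (1 - lam) := mul_nonneg (mul_nonneg hu' (hr0 k)) (by linarith)
        have h2 := hrcap k (Finset.mem_of_mem_erase hk)
        nlinarith
    have IH := ih (H'.erase h) (Finset.erase_ssubset hhH') (fun k hk => hH'H (Finset.mem_of_mem_erase hk)) c' hc'0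
      (rem - q) (by linarith) ρ hρ0 hρsupp (by rw [hρsum]; exact hlamR) hρcap
    -- identify the four terms
    have eB1 : (fun k => c k - u l₀ k * r'' k) = fun k => c' k - u l₀ k * ρ k := by
      funext k; rw [hr''def, hc'def, hρdef]; dsimp only; split_ifs with hkh
      · rw [hkh]; ring
      · ring
    have hg' : ∀ k ∈ H'.erase h, rowFill u P l₀ k (H'.erase h) c' (rem - q) = rowFill u P l₀ k H' c rem := by
      intro k hk
      rw [rowFill_of_ne_min' u P l₀ k H' hH' c rem (by rw [← hhdef]; exact Finset.ne_of_mem_erase hk), ← hhdef, ← hqdef]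
      exact rowFill_congr u P l₀ _ k c' c _ fun y hy => by
        rw [hc'def]; dsimp only; rw [if_neg (Finset.ne_of_mem_erase hy)]
    have hg'h : rowFill u P l₀ h (H'.erase h) c' (rem - q) = 0 :=
      rowFill_eq_zero_of_not_mem u P l₀ _ h c' _ (by simp)
    have eB2 : (fun k => c' k - u l₀ k * rowFill u P l₀ k (H'.erase h) c' (rem - q)) =
        fun k => c k - u l₀ k * rowFill u P l₀ k H' c rem := by
      funext k
      by_cases hkh : k = h
      · rw [hkh, hg'h, hq_eq, hc'def]; dsimp only; rw [if_pos rfl]; ring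
      · by_cases hkH' : k ∈ H'
        · rw [hg' k (Finset.mem_erase.2 ⟨hkh, hkH'⟩), hc'def]; dsimp only; rw [if_neg hkh]
        · rw [rowFill_eq_zero_of_not_mem u P l₀ _ k c' _ (fun hk => hkH' (Finset.mem_of_mem_erase hk)),
            rowFill_eq_zero_of_not_mem u P l₀ _ k c _ hkH', hc'def]; dsimp only; rw [if_neg hkh]
    have eB3 : ∑ k ∈ H', rowFill u P l₀ k H' c rem = q + ∑ k ∈ H'.erase h, rowFill u P l₀ k (H'.erase h) c' (rem - q) := by
      rw [← Finset.add_sum_erase H' _ hhH', hq_eq]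
      congr 1; exact Finset.sum_congr rfl fun k hk => (hg' k hk).symm
    -- assemble
    rw [hsplit, eB3, ← eB2]
    rw [eB1] at stepA
    have hΨ : r h + R ≤ (q + lam * R) - a := by rw [hadef]; ring_nf; exact le_rfl
    linarith [IH, stepA, hρsum]

end Greedy
end LawDec
end Quant
end Summit.CriticalPhenomena.PercolationContinuityZ3.Theorems
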